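import Summits.QuantumFields.YangMills.Theorems.BalabanUVNodesN15DefectKernelVectorPieceAdjDeriv
import Summits.QuantumFields.YangMills.Theorems.BalabanUVNodesN15DefectKernelVectorPieceTorus
import HarnessLib

/-!
# Route «BalabanUVNodes» (K4 «SpineRates»), node N15 = NE2, THE -a ∕ -b INTERFACE OF THE BACKGROUND LAYER, part 14: THE DERIVATIVE ENTRIES OF THE VECTOR
# SINGLE-SCALE PIECE ON THE CONCRETE UNIT-TORUS CARRIER — parts 12 and 13 with every GEOMETRIC binder discharged (non-vacuity, volume-uniform constants)

Cell `pub-ymgap`, seat `pub-ymgap-dag-n15-a` (KNIT-BY-NAME, generation g3; HUMAN RULING D-0062; chair R424 venue; `bears_on: R4∕N15`).  Filed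
`--supports stmt-QuantumFields-19351` (helper).  THEOREMS ONLY; imports BY NAME: part 12 `…VectorPieceDeriv` (`hasMaj_idef_vectorPieceDeriv`), part 13
`…VectorPieceAdjDeriv` (`hasMaj_idef_vectorPieceAdjDeriv`), part 10 `…VectorPieceTorus` (pattern), the carrier module `Literature/…/B6UnitTorusCarrier`
(`unitTorusGeo`, `triangle254_unitTorusGeo`, `rowSum_unitTorusGeo`, `card_fibre_unitBond`, `card_fibre_fineBond`, `pdist_rep_rep`).

WHY.  Part 10 instantiated entry 0 of the vector piece on the honest concrete carrier; THIS FILE does the same for the (3.42) second and third entries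
(parts 12, 13): carrier `unitTorusGeo L k M`, unit bonds ↦ base point (`nΩ = d + 1`), fine bonds ↦ King's block (`n_η = (d+1)(L^k)^{d+1}`), H-dominance with
EQUALITY at the halved rate `δ = δ_H∕2` (part 11's interpolated decay), C-dominance with EQUALITY at `δ_C = δ′` through the canonical indexing, (2.61) at
`σ_r = min(δ_H∕2, δ′)∕2` with the volume-independent `c_r = K_{d+1}(σ_r)`; the only binders left are the operators read off by their entries (inhabited:
`exists_reHkLin`, `exists_reDHkLin`, `exists_kingProj`) and a rate `0 ≤ ρ ≤ min(δ_H∕2, δ′)∕2`.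

HONEST FRAMING ∕ LIMITS.  Instantiation only (no new estimate); `U = 1` linear theory on finite tori; entry 3 `Δ_UG′` NOT covered (no printed∕tree input);
count-neutral; NOT a discharge of N15; one finite T⁴ at fixed ε — NOT infinite volume, NOT OS on ℝ⁴, NOT a mass gap, NOT Clay.
-/

noncomputable section

open scoped BigOperators
open Finset

namespace Summit.QuantumFields.YangMills.BalabanUVNodes.N15.DefectKernel

open Literature.MathematicalPhysics.QuantumFieldTheory.Balaban1983to89
open Literature.MathematicalPhysics.QuantumFieldTheory.Balaban1983to89.B11SectG (BlockNorm HasMaj RowSum)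
open Literature.MathematicalPhysics.QuantumFieldTheory.Balaban1983to89.T4EtaRateDefect (idef)
open Literature.MathematicalPhysics.QuantumFieldTheory.Balaban1983to89.T4EtaRateCoeffDefect (pull fibre)
open Literature.MathematicalPhysics.QuantumFieldTheory.Balaban1983to89.B4TorusKernel (periodConst)
open Literature.MathematicalPhysics.QuantumFieldTheory.Balaban1983to89.B5Prop11Plancherel (Tor fine)
open Literature.MathematicalPhysics.QuantumFieldTheory.Balaban1983to89.B5Hk163Strip (kappa163 kappa163_pos)
open Literature.MathematicalPhysics.QuantumFieldTheory.Balaban1983to89.B5Hk163Decay (MG163)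
open Literature.MathematicalPhysics.QuantumFieldTheory.Balaban1983to89.B5Hk163Torus (HkOp)
open Literature.MathematicalPhysics.QuantumFieldTheory.Balaban1983to89.B5Hk163TorusHolderDecay (MD163)
open Literature.MathematicalPhysics.QuantumFieldTheory.Balaban1983to89.T4Hk163StripRate (CGe)
open Literature.MathematicalPhysics.QuantumFieldTheory.Balaban1983to89.B6LowerBound2153Torus (rep rep_mem_pbox)
open Literature.MathematicalPhysics.QuantumFieldTheory.Balaban1983to89.B6Lemma24Torus (pbox)
open Literature.MathematicalPhysics.QuantumFieldTheory.Balaban1983to89.B6BondEliminationTorus (pdist)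
open Literature.MathematicalPhysics.QuantumFieldTheory.Balaban1983to89.B6Cov2156Torus (deltaPol bondReductionT one_le_M)
open Literature.MathematicalPhysics.QuantumFieldTheory.Balaban1983to89.B6UnitTorusCarrier (unitTorusGeo triangle254_unitTorusGeo
  unitTorusGeo_dist_nonneg unitTorusGeo_dist_symm rowSum_unitTorusGeo card_fibre_unitBond card_fibre_fineBond card_fibre_blockOf pdist_rep_rep)
open Literature.MathematicalPhysics.QuantumFieldTheory.Balaban1983to89.B5Hk163RateSum (C0maj C1maj T163)
open Literature.MathematicalPhysics.QuantumFieldTheory.King1986 (aK prop38RateConst prop38PosConst lemma43Const aliasConst)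
open Literature.MathematicalPhysics.QuantumFieldTheory.King1986.Torus (blockOf tdistT minimiser effLaplacian blockProj K45 delta45 gam0L)

variable {d : ℕ}

/-! ## §1 The derivative entry on the concrete carrier -/

/-- **THE DERIVATIVE OF THE VECTOR SINGLE-SCALE PIECE ON THE CONCRETE CARRIER** (part 12 on `unitTorusGeo L k M`, every geometric binder discharged;
H-dominance with EQUALITY at `δ = δ_H∕2`, (2.61) at `σ_r = min(δ_H∕2, δ′)∕2`): `𝔇((∂′H′)C′K′, (∂H)CK)` has the displayed explicit block majorant times
`e^{−ρ|y − y′|_T}` for every `0 ≤ ρ ≤ min(δ_H∕2, δ′)∕2`. [cite: King1986, (4.42)–(4.43) p.675, Prop. 3.8 (3.71) p.664 (second line); Balaban1984PropagatorsI, (1.63) p.28; Balaban1984PropagatorsII, (2.156) p.250, Lemma 2.1 (2.61) p.234] -/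
theorem hasMaj_idef_vectorPieceDeriv_unitTorus (hd : 1 ≤ d) {L : ℕ} [NeZero L] (hL : 1 ≤ L) {α γ : ℝ} (hα0 : 0 ≤ α) (hα1 : α < 1)
    (hγ0 : 0 < γ) (hγ1 : γ < 1) (ν : Fin (d + 1)) :
    ∃ B₀ C₁ δ' : ℝ, 0 < B₀ ∧ 0 < C₁ ∧ 0 < δ' ∧ ∀ (M : Fin (d + 1) → ℕ) [∀ μ, NeZero (M μ)] (_ : ∀ i, L ∣ M i)
      (k m : ℕ) (_ : 1 ≤ m)
      (pr : Tor (fine (L ^ m * L ^ k) M) → Tor (fine (L ^ k) M)) (_ : ∀ x' μ, (pr x' μ).val = (x' μ).val / L ^ m)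
      (prV : Tor (fine (L ^ m * L ^ k) M) × Fin (d + 1) → Tor (fine (L ^ k) M) × Fin (d + 1))
      (_ : ∀ i, prV i = (pr i.1, i.2))
      (H : (Tor M × Fin (d + 1) → ℝ) →ₗ[ℝ] (Tor (fine (L ^ k) M) × Fin (d + 1) → ℝ))
      (_ : ∀ b i, H (Pi.single b 1) i = (HkOp (L ^ k) M i b).re)
      (H' : (Tor M × Fin (d + 1) → ℝ) →ₗ[ℝ] (Tor (fine (L ^ m * L ^ k) M) × Fin (d + 1) → ℝ))
      (_ : ∀ b i, H' (Pi.single b 1) i = (HkOp (L ^ m * L ^ k) M i b).re)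
      (D : (Tor M × Fin (d + 1) → ℝ) →ₗ[ℝ] (Tor (fine (L ^ k) M) × Fin (d + 1) → ℝ))
      (_ : ∀ b i, D (Pi.single b 1) i = ((B5Prop11Plancherel.fdiff (fine (L ^ k) M) ((L ^ k : ℕ) : ℂ) ν * HkOp (L ^ k) M) i b).re)
      (D' : (Tor M × Fin (d + 1) → ℝ) →ₗ[ℝ] (Tor (fine (L ^ m * L ^ k) M) × Fin (d + 1) → ℝ))
      (_ : ∀ b i, D' (Pi.single b 1) i =
        ((B5Prop11Plancherel.fdiff (fine (L ^ m * L ^ k) M) ((L ^ m * L ^ k : ℕ) : ℂ) ν * HkOp (L ^ m * L ^ k) M) i b).re)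
      {w : ℝ} (_ : 0 ≤ w) (K : (Tor (fine (L ^ k) M) × Fin (d + 1) → ℝ) →ₗ[ℝ] (Tor M × Fin (d + 1) → ℝ))
      (_ : ∀ i b, K (Pi.single i 1) b = w * H (Pi.single b 1) i)
      (K' : (Tor (fine (L ^ m * L ^ k) M) × Fin (d + 1) → ℝ) →ₗ[ℝ] (Tor M × Fin (d + 1) → ℝ))
      (_ : ∀ i' b, K' (Pi.single i' 1) b = w / ((L : ℝ) ^ m) ^ (d + 1) * H' (Pi.single b 1) i')
      (C : (Tor M × Fin (d + 1) → ℝ) →ₗ[ℝ] (Tor M × Fin (d + 1) → ℝ))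
      (_ : ∀ b b', C (Pi.single b' 1) b =
        (bondReductionT L M (deltaPol M (L ^ k))).cov (⟨rep M b.1, rep_mem_pbox M b.1⟩, b.2) (⟨rep M b'.1, rep_mem_pbox M b'.1⟩, b'.2))
      (C' : (Tor M × Fin (d + 1) → ℝ) →ₗ[ℝ] (Tor M × Fin (d + 1) → ℝ))
      (_ : ∀ b b', C' (Pi.single b' 1) b =
        (bondReductionT L M (deltaPol M (L ^ (k + m)))).cov (⟨rep M b.1, rep_mem_pbox M b.1⟩, b.2) (⟨rep M b'.1, rep_mem_pbox M b'.1⟩, b'.2))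
      {ρ : ℝ} (_ : 0 ≤ ρ) (_ : ρ ≤ min (kappa163 (d + 1) / (d + 1) / 2) δ' / 2),
      HasMaj (BlockNorm.ofBlocks (unitTorusGeo L k M) (fun i : Tor (fine (L ^ k) M) × Fin (d + 1) => blockOf (L ^ k) M i.1))
        (BlockNorm.ofBlocks (unitTorusGeo L k M)
          ((fun i : Tor (fine (L ^ k) M) × Fin (d + 1) => blockOf (L ^ k) M i.1) ∘ prV))
        (idef (pull prV) (pull prV) (D' ∘ₗ (C' ∘ₗ K')) (D ∘ₗ (C ∘ₗ K)))
        (fun y y' =>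
          (((d + 1 : ℕ) : ℝ) * (MD163 (d + 1) * periodConst (kappa163 (d + 1)) d) * B4Sect5Proof.latticeConst (d + 1) (min (kappa163 (d + 1) / (d + 1) / 2) δ' / 2) *
              (((d + 1 : ℕ) : ℝ) * B₀ * B4Sect5Proof.latticeConst (d + 1) (min (kappa163 (d + 1) / (d + 1) / 2) δ' / 2) *
                  ((((d + 1) * (L ^ k) ^ (d + 1) : ℕ) : ℝ) * w * ((CGe (d + 1) + (d + 1) * MD163 (d + 1)) * periodConst (kappa163 (d + 1)) d / ((L ^ k : ℕ) : ℝ)))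
                + ((d + 1 : ℕ) : ℝ) * (C₁ * ((L : ℝ) ^ k)⁻¹) * B4Sect5Proof.latticeConst (d + 1) (min (kappa163 (d + 1) / (d + 1) / 2) δ' / 2) *
                  ((((d + 1) * (L ^ k) ^ (d + 1) : ℕ) : ℝ) * w * (MG163 (d + 1) * periodConst (kappa163 (d + 1)) d)))
            + ((d + 1 : ℕ) : ℝ) * ((2 ^ (1 - α) * (((d + 1 : ℕ) : ℝ) / ((L ^ k : ℕ) : ℝ)) ^ α *
                  (C0maj (d + 1) * (Real.pi * Real.pi ^ α) + C1maj (d + 1) * aliasConst (d + 1) α)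
                + T163 (d + 1) 0 γ / ((L ^ k : ℕ) : ℝ) ^ γ) ^ (1 / 2 : ℝ)
              * (2 * (MD163 (d + 1) * periodConst (kappa163 (d + 1)) d)) ^ (1 / 2 : ℝ)) * B4Sect5Proof.latticeConst (d + 1) (min (kappa163 (d + 1) / (d + 1) / 2) δ' / 2) *
              (((d + 1 : ℕ) : ℝ) * B₀ * B4Sect5Proof.latticeConst (d + 1) (min (kappa163 (d + 1) / (d + 1) / 2) δ' / 2) * ((((d + 1) * (L ^ k) ^ (d + 1) : ℕ) : ℝ) * w * (MG163 (d + 1) * periodConst (kappa163 (d + 1)) d)))) *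
          Real.exp (-(ρ * tdistT M y y'))) := by
  obtain ⟨B₀, C₁, δ', hB₀, hC₁, hδ', HP⟩ := hasMaj_idef_vectorPieceDeriv (d := d) hd hL hα0 hα1 hγ0 hγ1 ν
  refine ⟨B₀, C₁, δ', hB₀, hC₁, hδ', ?_⟩
  intro M _ hLM k m hm pr hpr prV hprV H hH H' hH' D hD D' hD' w hw0 K hK K' hK' C hC C' hC' ρ hρ hρ'
  have hσ : 0 < min (kappa163 (d + 1) / (d + 1) / 2) δ' / 2 :=
    half_pos (lt_min (half_pos (div_pos (kappa163_pos _) (by positivity))) hδ')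
  have hmin₁ : min (kappa163 (d + 1) / (d + 1) / 2) δ' ≤ kappa163 (d + 1) / (d + 1) / 2 := min_le_left _ _
  have hmin₂ : min (kappa163 (d + 1) / (d + 1) / 2) δ' ≤ δ' := min_le_right _ _
  exact HP M hLM k m hm (g := unitTorusGeo L k M) (triangle254_unitTorusGeo L k M) (unitTorusGeo_dist_nonneg L k M)
    (unitTorusGeo_dist_symm L k M) hσ.le (rowSum_unitTorusGeo L k M hσ)
    (fun b : Tor M × Fin (d + 1) => b.1) (fun y' => (card_fibre_unitBond M y').le)
    (fun i : Tor (fine (L ^ k) M) × Fin (d + 1) => blockOf (L ^ k) M i.1) (fun y' => (card_fibre_fineBond (L ^ k) M y').le)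
    pr hpr prV hprV H hH H' hH' D hD D' hD' hw0 K hK K' hK'
    (fun b : Tor M × Fin (d + 1) => ((⟨rep M b.1, rep_mem_pbox M b.1⟩, b.2) : B4.Idx (pbox M) (d + 1))) C hC C' hC'
    (δ := kappa163 (d + 1) / (d + 1) / 2) (fun b i => le_rfl)
    (δC := δ') (fun b b' => by rw [pdist_rep_rep])
    hρ (by linarith) (by linarith)

/-! ## §2 The adjoint-derivative entry on the concrete carrier -/

/-- **THE ADJOINT-DERIVATIVE ENTRY OF THE VECTOR SINGLE-SCALE PIECE ON THE CONCRETE CARRIER** (part 13 on `unitTorusGeo L k M`, every geometric binder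
discharged as in §1): `𝔇(H′C′(w′(∂′H′)ᵀ), HC(w(∂H)ᵀ))` has the displayed explicit block majorant times `e^{−ρ|y − y′|_T}` for every
`0 ≤ ρ ≤ min(δ_H∕2, δ′)∕2`. [cite: King1986, (4.42)–(4.43) p.675, Prop. 3.8 (3.71) p.664 (second line); Balaban1984PropagatorsI, (1.63) p.28; Balaban1984PropagatorsII, (2.156) p.250, Lemma 2.1 (2.61) p.234] -/
theorem hasMaj_idef_vectorPieceAdjDeriv_unitTorus (hd : 1 ≤ d) {L : ℕ} [NeZero L] (hL : 1 ≤ L) {α γ : ℝ} (hα0 : 0 ≤ α) (hα1 : α < 1)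
    (hγ0 : 0 < γ) (hγ1 : γ < 1) (ν : Fin (d + 1)) :
    ∃ B₀ C₁ δ' : ℝ, 0 < B₀ ∧ 0 < C₁ ∧ 0 < δ' ∧ ∀ (M : Fin (d + 1) → ℕ) [∀ μ, NeZero (M μ)] (_ : ∀ i, L ∣ M i)
      (k m : ℕ) (_ : 1 ≤ m)
      (pr : Tor (fine (L ^ m * L ^ k) M) → Tor (fine (L ^ k) M)) (_ : ∀ x' μ, (pr x' μ).val = (x' μ).val / L ^ m)
      (prV : Tor (fine (L ^ m * L ^ k) M) × Fin (d + 1) → Tor (fine (L ^ k) M) × Fin (d + 1))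
      (_ : ∀ i, prV i = (pr i.1, i.2))
      (H : (Tor M × Fin (d + 1) → ℝ) →ₗ[ℝ] (Tor (fine (L ^ k) M) × Fin (d + 1) → ℝ))
      (_ : ∀ b i, H (Pi.single b 1) i = (HkOp (L ^ k) M i b).re)
      (H' : (Tor M × Fin (d + 1) → ℝ) →ₗ[ℝ] (Tor (fine (L ^ m * L ^ k) M) × Fin (d + 1) → ℝ))
      (_ : ∀ b i, H' (Pi.single b 1) i = (HkOp (L ^ m * L ^ k) M i b).re)
      (D : (Tor M × Fin (d + 1) → ℝ) →ₗ[ℝ] (Tor (fine (L ^ k) M) × Fin (d + 1) → ℝ))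
      (_ : ∀ b i, D (Pi.single b 1) i = ((B5Prop11Plancherel.fdiff (fine (L ^ k) M) ((L ^ k : ℕ) : ℂ) ν * HkOp (L ^ k) M) i b).re)
      (D' : (Tor M × Fin (d + 1) → ℝ) →ₗ[ℝ] (Tor (fine (L ^ m * L ^ k) M) × Fin (d + 1) → ℝ))
      (_ : ∀ b i, D' (Pi.single b 1) i =
        ((B5Prop11Plancherel.fdiff (fine (L ^ m * L ^ k) M) ((L ^ m * L ^ k : ℕ) : ℂ) ν * HkOp (L ^ m * L ^ k) M) i b).re)
      {w : ℝ} (_ : 0 ≤ w) (K : (Tor (fine (L ^ k) M) × Fin (d + 1) → ℝ) →ₗ[ℝ] (Tor M × Fin (d + 1) → ℝ))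
      (_ : ∀ i b, K (Pi.single i 1) b = w * D (Pi.single b 1) i)
      (K' : (Tor (fine (L ^ m * L ^ k) M) × Fin (d + 1) → ℝ) →ₗ[ℝ] (Tor M × Fin (d + 1) → ℝ))
      (_ : ∀ i' b, K' (Pi.single i' 1) b = w / ((L : ℝ) ^ m) ^ (d + 1) * D' (Pi.single b 1) i')
      (C : (Tor M × Fin (d + 1) → ℝ) →ₗ[ℝ] (Tor M × Fin (d + 1) → ℝ))
      (_ : ∀ b b', C (Pi.single b' 1) b =
        (bondReductionT L M (deltaPol M (L ^ k))).cov (⟨rep M b.1, rep_mem_pbox M b.1⟩, b.2) (⟨rep M b'.1, rep_mem_pbox M b'.1⟩, b'.2))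
      (C' : (Tor M × Fin (d + 1) → ℝ) →ₗ[ℝ] (Tor M × Fin (d + 1) → ℝ))
      (_ : ∀ b b', C' (Pi.single b' 1) b =
        (bondReductionT L M (deltaPol M (L ^ (k + m)))).cov (⟨rep M b.1, rep_mem_pbox M b.1⟩, b.2) (⟨rep M b'.1, rep_mem_pbox M b'.1⟩, b'.2))
      {ρ : ℝ} (_ : 0 ≤ ρ) (_ : ρ ≤ min (kappa163 (d + 1) / (d + 1) / 2) δ' / 2),
      HasMaj (BlockNorm.ofBlocks (unitTorusGeo L k M) (fun i : Tor (fine (L ^ k) M) × Fin (d + 1) => blockOf (L ^ k) M i.1))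
        (BlockNorm.ofBlocks (unitTorusGeo L k M)
          ((fun i : Tor (fine (L ^ k) M) × Fin (d + 1) => blockOf (L ^ k) M i.1) ∘ prV))
        (idef (pull prV) (pull prV) (H' ∘ₗ (C' ∘ₗ K')) (H ∘ₗ (C ∘ₗ K)))
        (fun y y' =>
          (((d + 1 : ℕ) : ℝ) * (MG163 (d + 1) * periodConst (kappa163 (d + 1)) d) * B4Sect5Proof.latticeConst (d + 1) (min (kappa163 (d + 1) / (d + 1) / 2) δ' / 2) *
              (((d + 1 : ℕ) : ℝ) * B₀ * B4Sect5Proof.latticeConst (d + 1) (min (kappa163 (d + 1) / (d + 1) / 2) δ' / 2) *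
                  ((((d + 1) * (L ^ k) ^ (d + 1) : ℕ) : ℝ) * w * ((2 ^ (1 - α) * (((d + 1 : ℕ) : ℝ) / ((L ^ k : ℕ) : ℝ)) ^ α *
                  (C0maj (d + 1) * (Real.pi * Real.pi ^ α) + C1maj (d + 1) * aliasConst (d + 1) α)
                + T163 (d + 1) 0 γ / ((L ^ k : ℕ) : ℝ) ^ γ) ^ (1 / 2 : ℝ)
              * (2 * (MD163 (d + 1) * periodConst (kappa163 (d + 1)) d)) ^ (1 / 2 : ℝ)))
                + ((d + 1 : ℕ) : ℝ) * (C₁ * ((L : ℝ) ^ k)⁻¹) * B4Sect5Proof.latticeConst (d + 1) (min (kappa163 (d + 1) / (d + 1) / 2) δ' / 2) *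
                  ((((d + 1) * (L ^ k) ^ (d + 1) : ℕ) : ℝ) * w * (MD163 (d + 1) * periodConst (kappa163 (d + 1)) d)))
            + ((d + 1 : ℕ) : ℝ) * ((CGe (d + 1) + (d + 1) * MD163 (d + 1)) * periodConst (kappa163 (d + 1)) d / ((L ^ k : ℕ) : ℝ)) * B4Sect5Proof.latticeConst (d + 1) (min (kappa163 (d + 1) / (d + 1) / 2) δ' / 2) *
              (((d + 1 : ℕ) : ℝ) * B₀ * B4Sect5Proof.latticeConst (d + 1) (min (kappa163 (d + 1) / (d + 1) / 2) δ' / 2) * ((((d + 1) * (L ^ k) ^ (d + 1) : ℕ) : ℝ) * w * (MD163 (d + 1) * periodConst (kappa163 (d + 1)) d)))) *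
          Real.exp (-(ρ * tdistT M y y'))) := by
  obtain ⟨B₀, C₁, δ', hB₀, hC₁, hδ', HP⟩ := hasMaj_idef_vectorPieceAdjDeriv (d := d) hd hL hα0 hα1 hγ0 hγ1 ν
  refine ⟨B₀, C₁, δ', hB₀, hC₁, hδ', ?_⟩
  intro M _ hLM k m hm pr hpr prV hprV H hH H' hH' D hD D' hD' w hw0 K hK K' hK' C hC C' hC' ρ hρ hρ'
  have hσ : 0 < min (kappa163 (d + 1) / (d + 1) / 2) δ' / 2 :=
    half_pos (lt_min (half_pos (div_pos (kappa163_pos _) (by positivity))) hδ')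
  have hmin₁ : min (kappa163 (d + 1) / (d + 1) / 2) δ' ≤ kappa163 (d + 1) / (d + 1) / 2 := min_le_left _ _
  have hmin₂ : min (kappa163 (d + 1) / (d + 1) / 2) δ' ≤ δ' := min_le_right _ _
  exact HP M hLM k m hm (g := unitTorusGeo L k M) (triangle254_unitTorusGeo L k M) (unitTorusGeo_dist_nonneg L k M)
    (unitTorusGeo_dist_symm L k M) hσ.le (rowSum_unitTorusGeo L k M hσ)
    (fun b : Tor M × Fin (d + 1) => b.1) (fun y' => (card_fibre_unitBond M y').le)
    (fun i : Tor (fine (L ^ k) M) × Fin (d + 1) => blockOf (L ^ k) M i.1) (fun y' => (card_fibre_fineBond (L ^ k) M y').le)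
    pr hpr prV hprV H hH H' hH' D hD D' hD' hw0 K hK K' hK'
    (fun b : Tor M × Fin (d + 1) => ((⟨rep M b.1, rep_mem_pbox M b.1⟩, b.2) : B4.Idx (pbox M) (d + 1))) C hC C' hC'
    (δ := kappa163 (d + 1) / (d + 1) / 2) (fun b i => le_rfl)
    (δC := δ') (fun b b' => by rw [pdist_rep_rep])
    hρ (by linarith) (by linarith)

end Summit.QuantumFields.YangMills.BalabanUVNodes.N15.DefectKernel
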